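import Summits.CriticalPhenomena.SAWScalingLimit.Theorems.SAWDevelopingMapHexTightPerShellTight
import HarnessLib

/-!
# Where the boundary regime of (H1) lives: thin shells centred OFF the domain — crux `HexTight` (stmt-CriticalPhenomena-5423)

Crux `Summit.CriticalPhenomena.SAWScalingLimit.Theses.SAWDevelopingMap.HexTight`, line `reversal-virgin-disc`, seat c1
(`prover-line-stmt-CriticalPhenomena-5423-c1-0`). Companion of `SAWDevelopingMapHexTightExponentBootstrap.lean` and
`SAWDevelopingMapHexTightPerShellTight.lean` (per-shell rate-free tightness ⇒ (H1)). Pure plane geometry + bookkeeping.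

* `shellBound_of_perShellTight_thin` — per-shell tightness is only NEEDED on THIN shells: for any `c ≥ 4`, tightness of
  the traversal number on the shells of a class `good` with `c ρ < R ≤ 1` gives the traversal bound with every exponent
  `λ'` (constant `c^{λ'}`) on the whole class, all meshes `0 < δ ≤ ρ` (thick shells are absorbed in the constant; thin ones
  as in `traversalBound_of_perShellTight`: tolerance `(ρ/R)^{λ'}` below the per-shell mesh bound, empty event above it by
  `exists_coarse_cutoff`).
* `boundaryPerShellTight_of_offDomain` — **the boundary shells reduce to thin shells centred in `Ωᶜ`** (plus thin
  interior shells): for an open `Ω` and a boundary shell `D(x; ρ, R)` (`closedBall x R ⊄ Ω`, `64ρ < R ≤ 1`) let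
  `d = infDist x Ωᶜ ≤ R`; if `8ρ < d` the interior thin shell `D(x; ρ, d/2)` (`closedBall x (d/2) ⊆ Ω`) is traversed as
  often as `D(x; ρ, R)`; if `d ≤ 8ρ`, a nearest point `x' ∈ Ωᶜ` (`dist x x' = d`) gives the thin shell `D(x'; 9ρ, R - 8ρ)`
  centred in `Ωᶜ`, traversed as often (`Curve.HasTraversals.mono`). Per-shell tightness transfers along the inclusion of
  events (`δ ≤ ρ ≤ 9ρ`).
* `traversalBound_of_interiorThin_of_offDomain`, `hexTight_of_interiorThin_of_offDomain` — hence (H1) (`λ = 3`,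
  `δ₀ = 1`) and the crux `HexTight` follow from: (i) per-shell tightness of the traversal number on thin INTERIOR shells
  (`4ρ < R ≤ 1`, `closedBall x R ⊆ Ω` — the regime the line's virginization reduces to arc atoms) and (ii) per-shell
  tightness on thin shells CENTRED IN `Ωᶜ` (`4ρ < R ≤ 1`, `x ∉ Ω`) — the boundary atom in its barest form (for each such
  shell the number of separate traversals by the critical SAW polyline is tight as `δ → 0`; heuristically the worst
  centre is the tip of an inward slit, where two unforced visits cost the exponent `7/2`).

* `interiorPerShellTight_of_interiorBound_one` — the interior-restricted converse (an interior traversal bound with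
  some exponent `> 1`, e.g. the line's landed `InteriorShellBound`, gives thin-interior per-shell tightness: the net shells
  of the localization are interior), and `hexTight_of_interiorBound_one_of_offDomain` — the ASSEMBLED REDUCTION OF THE
  CRUX: interior bound (λ > 1) + per-shell tightness on thin shells centred in `(D.carrier)ᶜ` ⇒ `HexTight`.

References: M. Aizenman, A. Burchard, Duke Math. J. 99 (1999) §1.a–b, §3.a (moving the centre of a shell)
[AizenmanBurchardDuke1999]; H. Duminil-Copin, S. Smirnov, Ann. of Math. 175 (2012) §4 [DuminilCopinSmirnov2012].
-/

noncomputable section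

open scoped BigOperators Classical
open MeasureTheory Filter Topology Set Metric
open Literature.Probability.LatticeModels Literature.Probability.RandomPlanarGeometry
  Literature.Probability.RandomPlanarGeometry.SAW

namespace Summit.CriticalPhenomena.SAWScalingLimit.Theorems.HexTight.ExponentBootstrap

/-! ### Per-shell tightness is only needed on thin shells -/

/-- **Per-shell tightness on the THIN shells of a class ⇒ the traversal bound with every exponent on the class.** For
`c ≥ 4`: if for each shell `D(x; ρ, R)` of the class `good` with `0 < ρ`, `c ρ < R ≤ 1` and each `η > 0` there are `k`,
`δ₁ > 0` with `P_δ(k separate traversals) ≤ η` for `δ ∈ (0, δ₁]`, `δ ≤ ρ`, then for every `λ' > 0` a threshold per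
shell gives `P_δ(k'(x,ρ,R) separate traversals) ≤ c^{λ'} (ρ/R)^{λ'}` for all `0 < δ ≤ ρ < R ≤ 1` on the class. -/
theorem shellBound_of_perShellTight_thin (c : ℝ) (hc : 4 ≤ c) (good : ℂ → ℝ → Prop) :
    ∀ (Ω : Set ℂ) (a b : ℝ → HexVertex),
      (∀ (x : ℂ) (ρ R : ℝ), 0 < ρ → c * ρ < R → R ≤ 1 → good x R → ∀ η : ℝ, 0 < η →
        ∃ (k : ℕ) (δ₁ : ℝ), 0 < δ₁ ∧ ∀ δ ∈ Set.Ioc (0 : ℝ) δ₁, δ ≤ ρ →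
          hexSAWLaw Ω δ (a δ) (b δ)
            {γ | (⟨γ.walk.toCurve fun v => (δ : ℂ) * hexCenter v⟩ : Curve ℂ).HasTraversals k x ρ R} ≤
            ENNReal.ofReal η) →
      ∀ (lam' : ℝ), 0 < lam' →
        ∃ k' : ℂ → ℝ → ℝ → ℕ, ∀ (δ : ℝ) (x : ℂ) (ρ R : ℝ), 0 < δ → δ ≤ ρ → ρ < R → R ≤ 1 → good x R →
          hexSAWLaw Ω δ (a δ) (b δ)
            {γ | (⟨γ.walk.toCurve fun v => (δ : ℂ) * hexCenter v⟩ : Curve ℂ).HasTraversals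
              (k' x ρ R) x ρ R} ≤ ENNReal.ofReal (c ^ lam' * (ρ / R) ^ lam') := by
  intro Ω a b h lam' hlam'
  suffices key : ∀ (x : ℂ) (ρ R : ℝ), ∃ kk : ℕ, ∀ δ : ℝ, 0 < δ → δ ≤ ρ → ρ < R → R ≤ 1 → good x R →
      hexSAWLaw Ω δ (a δ) (b δ)
        {γ | (⟨γ.walk.toCurve fun v => (δ : ℂ) * hexCenter v⟩ : Curve ℂ).HasTraversals kk x ρ R} ≤
        ENNReal.ofReal (c ^ lam' * (ρ / R) ^ lam') by
    choose kk hkk using key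
    exact ⟨kk, fun δ x ρ R h₀ h₁ h₂ h₃ h₄ => hkk x ρ R δ h₀ h₁ h₂ h₃ h₄⟩
  intro x ρ R
  by_cases hshell : 0 < ρ ∧ ρ < R ∧ R ≤ 1 ∧ good x R
  swap
  · exact ⟨0, fun δ hδ hδρ hρR hR1 hg => (hshell ⟨hδ.trans_le hδρ, hρR, hR1, hg⟩).elim⟩
  obtain ⟨hρ, hρR, hR1, hg⟩ := hshell
  have hR : 0 < R := hρ.trans hρR
  have hc0 : 0 < c := by linarith
  have ht0 : 0 < ρ / R := div_pos hρ hR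
  have hc1 : (1 : ℝ) ≤ c ^ lam' := Real.one_le_rpow (by linarith) hlam'.le
  have hε : 0 < (ρ / R) ^ lam' := Real.rpow_pos_of_pos ht0 _
  -- thick shells are absorbed in the constant
  by_cases hthick : R ≤ c * ρ
  · refine ⟨0, fun δ _ _ _ _ _ => (embLaw_apply_le_one _).trans (ENNReal.one_le_ofReal.2 ?_)⟩
    rw [← Real.mul_rpow hc0.le ht0.le]
    refine Real.one_le_rpow ?_ hlam'.le
    rw [mul_div_assoc', le_div_iff₀ hR]; linarith
  rw [not_le] at hthick
  have h4ρ : 4 * ρ < R := lt_of_le_of_lt (by nlinarith) hthick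
  obtain ⟨k, δ₁, hδ₁, hk⟩ := h x ρ R hρ hthick hR1 hg _ hε
  have hw : 0 < min δ₁ ρ := lt_min hδ₁ hρ
  obtain ⟨kc, hkc⟩ := exists_coarse_cutoff x ρ R (min δ₁ ρ) hw
  refine ⟨max k kc, fun δ hδ hδρ _ _ _ => ?_⟩
  by_cases hfine : δ ≤ δ₁
  · calc hexSAWLaw Ω δ (a δ) (b δ) _
        ≤ hexSAWLaw Ω δ (a δ) (b δ)
            {γ | (⟨γ.walk.toCurve fun v => (δ : ℂ) * hexCenter v⟩ : Curve ℂ).HasTraversals k x ρ R} :=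
          measure_mono fun γ hγ => Curve.HasTraversals.of_le hγ (le_max_left _ _)
      _ ≤ ENNReal.ofReal ((ρ / R) ^ lam') := hk δ ⟨hδ, hfine⟩ hδρ
      _ ≤ ENNReal.ofReal (c ^ lam' * (ρ / R) ^ lam') :=
          ENNReal.ofReal_le_ofReal (le_mul_of_one_le_left hε.le hc1)
  · rw [not_le] at hfine
    have hempty : {γ : HexDomainSAW Ω δ (a δ) (b δ) |
        (⟨γ.walk.toCurve fun v => (δ : ℂ) * hexCenter v⟩ : Curve ℂ).HasTraversals (max k kc) x ρ R} = ∅ :=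
      Set.eq_empty_of_forall_notMem fun γ hγ =>
        hkc Ω δ (a δ) (b δ) ((min_le_left _ _).trans hfine.le) hδρ (by linarith) γ
          (Curve.HasTraversals.of_le hγ (le_max_right _ _))
    rw [hempty, measure_empty]
    exact bot_le

/-! ### Boundary shells reduce to thin shells centred off the domain -/

/-- **Boundary per-shell tightness from interior-thin and off-domain-thin per-shell tightness.** Let `Ω` be open.
Suppose the traversal number is tight as `δ → 0` (i) on every thin interior shell (`0 < ρ`, `4ρ < R ≤ 1`,
`closedBall x R ⊆ Ω`) and (ii) on every thin shell centred in `Ωᶜ` (`0 < ρ`, `4ρ < R ≤ 1`, `x ∉ Ω`). Then it is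
tight on every boundary shell `D(x; ρ, R)` with `64ρ < R ≤ 1`, `closedBall x R ⊄ Ω`: with `d = infDist x Ωᶜ`
(`≤ R`), if `8ρ < d` every traversal of `D(x; ρ, R)` is one of the interior thin shell `D(x; ρ, d/2)`; otherwise a
nearest point `x' ∈ Ωᶜ` (`dist x x' = d ≤ 8ρ`) centres the thin shell `D(x'; 9ρ, R - 8ρ)`, traversed as often
(`Curve.HasTraversals.mono`). -/
theorem boundaryPerShellTight_of_offDomain :
    ∀ (Ω : Set ℂ), IsOpen Ω → ∀ (a b : ℝ → HexVertex),
      (∀ (x : ℂ) (ρ R : ℝ), 0 < ρ → 4 * ρ < R → R ≤ 1 → Metric.closedBall x R ⊆ Ω → ∀ η : ℝ, 0 < η →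
        ∃ (k : ℕ) (δ₁ : ℝ), 0 < δ₁ ∧ ∀ δ ∈ Set.Ioc (0 : ℝ) δ₁, δ ≤ ρ →
          hexSAWLaw Ω δ (a δ) (b δ)
            {γ | (⟨γ.walk.toCurve fun v => (δ : ℂ) * hexCenter v⟩ : Curve ℂ).HasTraversals k x ρ R} ≤
            ENNReal.ofReal η) →
      (∀ (x : ℂ) (ρ R : ℝ), 0 < ρ → 4 * ρ < R → R ≤ 1 → x ∉ Ω → ∀ η : ℝ, 0 < η →
        ∃ (k : ℕ) (δ₁ : ℝ), 0 < δ₁ ∧ ∀ δ ∈ Set.Ioc (0 : ℝ) δ₁, δ ≤ ρ →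
          hexSAWLaw Ω δ (a δ) (b δ)
            {γ | (⟨γ.walk.toCurve fun v => (δ : ℂ) * hexCenter v⟩ : Curve ℂ).HasTraversals k x ρ R} ≤
            ENNReal.ofReal η) →
      ∀ (x : ℂ) (ρ R : ℝ), 0 < ρ → 64 * ρ < R → R ≤ 1 → ¬ Metric.closedBall x R ⊆ Ω → ∀ η : ℝ, 0 < η →
        ∃ (k : ℕ) (δ₁ : ℝ), 0 < δ₁ ∧ ∀ δ ∈ Set.Ioc (0 : ℝ) δ₁, δ ≤ ρ →
          hexSAWLaw Ω δ (a δ) (b δ)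
            {γ | (⟨γ.walk.toCurve fun v => (δ : ℂ) * hexCenter v⟩ : Curve ℂ).HasTraversals k x ρ R} ≤
            ENNReal.ofReal η := by
  intro Ω hΩ a b hI hC x ρ R hρ hρR hR1 hbdry η hη
  -- the complement is closed and nonempty, `d = infDist x Ωᶜ ≤ R`
  have hCcl : IsClosed Ωᶜ := hΩ.isClosed_compl
  obtain ⟨z, hzR, hzΩ⟩ : ∃ z, z ∈ Metric.closedBall x R ∧ z ∉ Ω := Set.not_subset.1 hbdry
  have hCne : (Ωᶜ : Set ℂ).Nonempty := ⟨z, hzΩ⟩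
  obtain ⟨x', hx'Ω, hd⟩ := hCcl.exists_infDist_eq_dist hCne x
  -- `hd : infDist x Ωᶜ = dist x x'`
  have hdR : dist x x' ≤ R := by
    rw [← hd]
    exact (Metric.infDist_le_dist_of_mem (x := x) (Set.mem_compl hzΩ)).trans
      (by rwa [Metric.mem_closedBall, dist_comm] at hzR)
  have hball : ∀ y : ℂ, dist y x < dist x x' → y ∈ Ω := by
    intro y hy
    by_contra hyΩ
    have := Metric.infDist_le_dist_of_mem (x := x) (Set.mem_compl hyΩ)
    rw [hd] at this
    linarith [dist_comm x y]
  -- transfer of per-shell tightness along an inclusion of events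
  have transfer : ∀ (x₁ : ℂ) (ρ₁ R₁ : ℝ), ρ ≤ ρ₁ →
      (∀ (γ : Curve ℂ) (k : ℕ), γ.HasTraversals k x ρ R → γ.HasTraversals k x₁ ρ₁ R₁) →
      (∃ (k : ℕ) (δ₁ : ℝ), 0 < δ₁ ∧ ∀ δ ∈ Set.Ioc (0 : ℝ) δ₁, δ ≤ ρ₁ →
        hexSAWLaw Ω δ (a δ) (b δ)
          {γ | (⟨γ.walk.toCurve fun v => (δ : ℂ) * hexCenter v⟩ : Curve ℂ).HasTraversals k x₁ ρ₁ R₁} ≤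
          ENNReal.ofReal η) →
      ∃ (k : ℕ) (δ₁ : ℝ), 0 < δ₁ ∧ ∀ δ ∈ Set.Ioc (0 : ℝ) δ₁, δ ≤ ρ →
        hexSAWLaw Ω δ (a δ) (b δ)
          {γ | (⟨γ.walk.toCurve fun v => (δ : ℂ) * hexCenter v⟩ : Curve ℂ).HasTraversals k x ρ R} ≤
          ENNReal.ofReal η := by
    intro x₁ ρ₁ R₁ hρ₁ hmono ⟨k, δ₁, hδ₁, hk⟩
    exact ⟨k, δ₁, hδ₁, fun δ hδ hδρ =>
      (measure_mono fun γ hγ => hmono _ k hγ).trans (hk δ hδ (hδρ.trans hρ₁))⟩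
  by_cases hfar : 8 * ρ < dist x x'
  · -- interior thin shell `D(x; ρ, d/2)`
    have hsub : Metric.closedBall x (dist x x' / 2) ⊆ Ω := fun y hy => hball y (by
      rw [Metric.mem_closedBall] at hy; linarith [dist_nonneg (x := x) (y := x')])
    refine transfer x ρ (dist x x' / 2) le_rfl (fun γ k hγ => hγ.mono' le_rfl (by linarith)) ?_
    exact hI x ρ (dist x x' / 2) hρ (by linarith) (by linarith) hsub η hη
  · -- off-domain thin shell `D(x'; 9ρ, R - 8ρ)`
    rw [not_lt] at hfar
    refine transfer x' (9 * ρ) (R - 8 * ρ) (by linarith) (fun γ k hγ => hγ.mono (by linarith) (by linarith)) ?_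
    exact hC x' (9 * ρ) (R - 8 * ρ) (by linarith) (by linarith) (by linarith) hx'Ω η hη

/-! ### (H1) and the crux from the two thin per-shell atoms -/

/-- **(H1) from thin-interior and thin-off-domain per-shell tightness.** For an open `Ω`: per-shell rate-free tightness
of the traversal number on thin interior shells and on thin shells centred in `Ωᶜ` gives the all-shells traversal bound
with `K = 64³`, `λ = 3 > 2`, `δ₀ = 1` (interior shells by `shellBound_of_perShellTight_thin 4`, boundary shells by
`boundaryPerShellTight_of_offDomain` + `shellBound_of_perShellTight_thin 64`, combined shell by shell). -/
theorem traversalBound_of_interiorThin_of_offDomain {Ω : Set ℂ} (hΩ : IsOpen Ω) {a b : ℝ → HexVertex}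
    (hI : ∀ (x : ℂ) (ρ R : ℝ), 0 < ρ → 4 * ρ < R → R ≤ 1 → Metric.closedBall x R ⊆ Ω → ∀ η : ℝ, 0 < η →
      ∃ (k : ℕ) (δ₁ : ℝ), 0 < δ₁ ∧ ∀ δ ∈ Set.Ioc (0 : ℝ) δ₁, δ ≤ ρ →
        hexSAWLaw Ω δ (a δ) (b δ)
          {γ | (⟨γ.walk.toCurve fun v => (δ : ℂ) * hexCenter v⟩ : Curve ℂ).HasTraversals k x ρ R} ≤
          ENNReal.ofReal η)
    (hC : ∀ (x : ℂ) (ρ R : ℝ), 0 < ρ → 4 * ρ < R → R ≤ 1 → x ∉ Ω → ∀ η : ℝ, 0 < η →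
      ∃ (k : ℕ) (δ₁ : ℝ), 0 < δ₁ ∧ ∀ δ ∈ Set.Ioc (0 : ℝ) δ₁, δ ≤ ρ →
        hexSAWLaw Ω δ (a δ) (b δ)
          {γ | (⟨γ.walk.toCurve fun v => (δ : ℂ) * hexCenter v⟩ : Curve ℂ).HasTraversals k x ρ R} ≤
          ENNReal.ofReal η) :
    ∃ (k : ℂ → ℝ → ℝ → ℕ) (K lam δ₀ : ℝ), 0 ≤ K ∧ 2 < lam ∧ 0 < δ₀ ∧
      ∀ δ ∈ Set.Ioc (0 : ℝ) δ₀, ∀ (x : ℂ) (ρ R : ℝ), δ ≤ ρ → ρ < R → R ≤ 1 →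
        hexSAWLaw Ω δ (a δ) (b δ)
          {γ | (⟨γ.walk.toCurve fun v => (δ : ℂ) * hexCenter v⟩ : Curve ℂ).HasTraversals
            (k x ρ R) x ρ R} ≤ ENNReal.ofReal (K * (ρ / R) ^ lam) := by
  -- interior shells, constant `4³`
  obtain ⟨k₁, hk₁⟩ := shellBound_of_perShellTight_thin 4 le_rfl (fun x R => Metric.closedBall x R ⊆ Ω) Ω a b
    (fun x ρ R hρ hρR hR1 hg η hη => hI x ρ R hρ hρR hR1 hg η hη) 3 (by norm_num)
  -- boundary shells, constant `64³`
  obtain ⟨k₂, hk₂⟩ := shellBound_of_perShellTight_thin 64 (by norm_num) (fun x R => ¬ Metric.closedBall x R ⊆ Ω)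
    Ω a b (fun x ρ R hρ hρR hR1 hg η hη => boundaryPerShellTight_of_offDomain Ω hΩ a b hI hC x ρ R hρ hρR hR1 hg η hη)
    3 (by norm_num)
  refine ⟨fun x ρ R => max (k₁ x ρ R) (k₂ x ρ R), (64 : ℝ) ^ (3 : ℝ), 3, 1, by positivity, by norm_num, one_pos,
    fun δ hδ x ρ R hδρ hρR hR1 => ?_⟩
  have hρ : 0 < ρ := hδ.1.trans_le hδρ
  have ht0 : 0 ≤ ρ / R := (div_pos hρ (hρ.trans hρR)).le
  have h464 : (4 : ℝ) ^ (3 : ℝ) * (ρ / R) ^ (3 : ℝ) ≤ (64 : ℝ) ^ (3 : ℝ) * (ρ / R) ^ (3 : ℝ) :=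
    mul_le_mul_of_nonneg_right (Real.rpow_le_rpow (by norm_num) (by norm_num) (by norm_num))
      (Real.rpow_nonneg ht0 _)
  by_cases hin : Metric.closedBall x R ⊆ Ω
  · calc hexSAWLaw Ω δ (a δ) (b δ) _
        ≤ hexSAWLaw Ω δ (a δ) (b δ)
            {γ | (⟨γ.walk.toCurve fun v => (δ : ℂ) * hexCenter v⟩ : Curve ℂ).HasTraversals (k₁ x ρ R) x ρ R} :=
          measure_mono fun γ hγ => Curve.HasTraversals.of_le hγ (le_max_left _ _)
      _ ≤ ENNReal.ofReal ((4 : ℝ) ^ (3 : ℝ) * (ρ / R) ^ (3 : ℝ)) := hk₁ δ x ρ R hδ.1 hδρ hρR hR1 hin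
      _ ≤ ENNReal.ofReal ((64 : ℝ) ^ (3 : ℝ) * (ρ / R) ^ (3 : ℝ)) := ENNReal.ofReal_le_ofReal h464
  · calc hexSAWLaw Ω δ (a δ) (b δ) _
        ≤ hexSAWLaw Ω δ (a δ) (b δ)
            {γ | (⟨γ.walk.toCurve fun v => (δ : ℂ) * hexCenter v⟩ : Curve ℂ).HasTraversals (k₂ x ρ R) x ρ R} :=
          measure_mono fun γ hγ => Curve.HasTraversals.of_le hγ (le_max_right _ _)
      _ ≤ ENNReal.ofReal ((64 : ℝ) ^ (3 : ℝ) * (ρ / R) ^ (3 : ℝ)) := hk₂ δ x ρ R hδ.1 hδρ hρR hR1 hin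

/-- **`HexTight` from the two thin per-shell atoms.** If for every Dobrushin domain and hexagonal endpoint
approximation the number of separate shell traversals of the critical SAW polyline is tight as `δ → 0` (i) on every
thin interior shell and (ii) on every thin shell centred in the complement of the domain, then the critical hexagonal
SAW laws are eventually tight (`…Theses.SAWDevelopingMap.HexTight`), through `traversalBound_of_interiorThin_of_offDomain`
(`D.carrier` is open) and the landed rung `MarginalWedge.stub_hexTight_of_traversalBound`. -/
theorem hexTight_of_interiorThin_of_offDomain
    (hI : ∀ (D : DobrushinDomain) (a b : ℝ → HexVertex), IsEmbEndpointApprox hexGraph hexCenter D a b →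
      ∀ (x : ℂ) (ρ R : ℝ), 0 < ρ → 4 * ρ < R → R ≤ 1 → Metric.closedBall x R ⊆ D.carrier → ∀ η : ℝ, 0 < η →
        ∃ (k : ℕ) (δ₁ : ℝ), 0 < δ₁ ∧ ∀ δ ∈ Set.Ioc (0 : ℝ) δ₁, δ ≤ ρ →
          hexSAWLaw D.carrier δ (a δ) (b δ)
            {γ | (⟨γ.walk.toCurve fun v => (δ : ℂ) * hexCenter v⟩ : Curve ℂ).HasTraversals k x ρ R} ≤
            ENNReal.ofReal η)
    (hC : ∀ (D : DobrushinDomain) (a b : ℝ → HexVertex), IsEmbEndpointApprox hexGraph hexCenter D a b →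
      ∀ (x : ℂ) (ρ R : ℝ), 0 < ρ → 4 * ρ < R → R ≤ 1 → x ∉ D.carrier → ∀ η : ℝ, 0 < η →
        ∃ (k : ℕ) (δ₁ : ℝ), 0 < δ₁ ∧ ∀ δ ∈ Set.Ioc (0 : ℝ) δ₁, δ ≤ ρ →
          hexSAWLaw D.carrier δ (a δ) (b δ)
            {γ | (⟨γ.walk.toCurve fun v => (δ : ℂ) * hexCenter v⟩ : Curve ℂ).HasTraversals k x ρ R} ≤
            ENNReal.ofReal η) :
    Summit.CriticalPhenomena.SAWScalingLimit.Theses.SAWDevelopingMap.HexTight := by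
  refine HexConjecture.MarginalWedge.stub_hexTight_of_traversalBound fun D a b hab => ?_
  exact traversalBound_of_interiorThin_of_offDomain D.isOpen (hI D a b hab) (hC D a b hab)


/-! ### Interior per-shell tightness from an interior traversal bound, and the assembled reduction of the crux -/

/-- **Interior traversal bound with some exponent `> 1` ⇒ thin-interior per-shell tightness** (the interior-restricted
converse: the net shells `D(c_j; w, hh - w)` of the localization sit inside `closedBall x R ⊆ Ω`, `dist c_j x = m`,
`m + hh = R`, so only the INTERIOR bound is consumed). This is the form in which the line's landed
`Reversal.stub_virginizationTight` output (`InteriorShellBound`, `λ = 3`) feeds `boundaryPerShellTight_of_offDomain`. -/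
theorem interiorPerShellTight_of_interiorBound_one :
    ∀ (Ω : Set ℂ) (a b : ℝ → HexVertex),
      (∃ (k : ℂ → ℝ → ℝ → ℕ) (K lam δ₀ : ℝ), 0 ≤ K ∧ 1 < lam ∧ 0 < δ₀ ∧
        ∀ δ ∈ Set.Ioc (0 : ℝ) δ₀, ∀ (x : ℂ) (ρ R : ℝ), δ ≤ ρ → ρ < R → R ≤ 1 →
          Metric.closedBall x R ⊆ Ω →
          hexSAWLaw Ω δ (a δ) (b δ)
            {γ | (⟨γ.walk.toCurve fun v => (δ : ℂ) * hexCenter v⟩ : Curve ℂ).HasTraversals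
              (k x ρ R) x ρ R} ≤ ENNReal.ofReal (K * (ρ / R) ^ lam)) →
      ∀ (x : ℂ) (ρ R : ℝ), 0 < ρ → 4 * ρ < R → R ≤ 1 → Metric.closedBall x R ⊆ Ω → ∀ η : ℝ, 0 < η →
        ∃ (k' : ℕ) (δ₁ : ℝ), 0 < δ₁ ∧ ∀ δ ∈ Set.Ioc (0 : ℝ) δ₁, δ ≤ ρ →
          hexSAWLaw Ω δ (a δ) (b δ)
            {γ | (⟨γ.walk.toCurve fun v => (δ : ℂ) * hexCenter v⟩ : Curve ℂ).HasTraversals k' x ρ R} ≤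
            ENNReal.ofReal η := by
  intro Ω a b hI
  obtain ⟨k, K, lam, δ₀, hK, hlam, hδ₀, h⟩ := hI
  intro x ρ R hρ h4 hR1 hin η hη
  have hρR : ρ < R := by linarith
  -- middle radius `m`, half width `hh`
  obtain ⟨m, hm⟩ : ∃ m : ℝ, m = (ρ + R) / 2 := ⟨_, rfl⟩
  obtain ⟨hh, hhh⟩ : ∃ hh : ℝ, hh = (R - ρ) / 2 := ⟨_, rfl⟩
  have hmpos : 0 < m := by rw [hm]; linarith
  have hhpos : 0 < hh := by rw [hhh]; linarith
  have hmR : m + hh = R := by rw [hm, hhh]; ring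
  -- the union-bound constant and the net size
  obtain ⟨C₀, hC₀⟩ : ∃ C₀ : ℝ, C₀ = 4 * Real.pi * m / hh := ⟨_, rfl⟩
  have hC₀pos : 0 < C₀ := by rw [hC₀]; positivity
  obtain ⟨M₀, hM₀⟩ := Filter.eventually_atTop.1
    ((tendsto_unionBound (K := K) hC₀pos.le hlam).eventually (Iio_mem_nhds hη))
  obtain ⟨M, hMdef⟩ : ∃ M : ℕ, M = max M₀ (⌈C₀⌉₊ + 1) := ⟨_, rfl⟩
  have hMM₀ : M₀ ≤ M := hMdef ▸ le_max_left _ _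
  have hMC : C₀ < M := by
    have h1 : ((⌈C₀⌉₊ + 1 : ℕ) : ℝ) ≤ M := by rw [hMdef]; exact_mod_cast le_max_right _ _
    have h2 : C₀ < ((⌈C₀⌉₊ + 1 : ℕ) : ℝ) := by
      push_cast; linarith [Nat.le_ceil C₀]
    linarith
  have hMpos : (0 : ℝ) < M := hC₀pos.trans hMC
  have hM1 : 1 ≤ M := by
    rw [hMdef]; exact le_max_of_le_right (Nat.succ_le_succ (Nat.zero_le _))
  have hsmall : (M : ℝ) * (K * (C₀ / M) ^ lam) < η := hM₀ M hMM₀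
  -- radii of the small shells
  obtain ⟨w, hw⟩ : ∃ w : ℝ, w = 2 * Real.pi * ((ρ + R) / 2) / M := ⟨_, rfl⟩
  have hw' : w = C₀ * hh / (2 * M) := by
    rw [hw, hC₀, ← hm]; field_simp; ring
  have hwpos : 0 < w := by rw [hw']; positivity
  have h2w : 2 * w < hh := by
    rw [hw', show C₀ * hh / (2 * M) = (C₀ / M) * hh / 2 by field_simp]
    have : C₀ / M < 1 := (div_lt_one hMpos).2 hMC
    nlinarith
  have hratio : w / (hh - w) ≤ C₀ / M := by
    have hden : hh / 2 ≤ hh - w := by linarith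
    calc w / (hh - w) ≤ w / (hh / 2) := div_le_div_of_nonneg_left hwpos.le (by positivity) hden
      _ = C₀ / M := by rw [hw']; field_simp
  -- net centres; they are at distance `m` from `x`, so the small shells are interior
  obtain ⟨c, hc⟩ : ∃ c : ℕ → ℂ, c = fun j : ℕ => x + (((ρ + R) / 2 : ℝ) : ℂ) *
      Complex.exp (((-Real.pi + 2 * Real.pi * (j : ℝ) / M : ℝ) : ℂ) * Complex.I) := ⟨_, rfl⟩
  have hcdist : ∀ j : ℕ, dist (c j) x = m := by
    intro j
    rw [hc]
    simp only [dist_eq_norm, add_sub_cancel_left, norm_mul, Complex.norm_real, Complex.norm_exp_ofReal_mul_I,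
      mul_one, Real.norm_eq_abs, ← hm]
    exact abs_of_pos hmpos
  have hcin : ∀ j : ℕ, Metric.closedBall (c j) (hh - w) ⊆ Ω := by
    intro j y hy
    refine hin ?_
    rw [Metric.mem_closedBall] at hy ⊢
    calc dist y x ≤ dist y (c j) + dist (c j) x := dist_triangle _ _ _
      _ ≤ (hh - w) + m := by rw [hcdist]; linarith
      _ ≤ R := by linarith
  refine ⟨∑ j ∈ Finset.range M, k (c j) w (hh - w), min w δ₀, lt_min hwpos hδ₀, fun δ hδ _ => ?_⟩
  have hfine : δ ≤ w := hδ.2.trans (min_le_left _ _)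
  have hδ' : δ ∈ Set.Ioc (0 : ℝ) δ₀ := ⟨hδ.1, hδ.2.trans (min_le_right _ _)⟩
  have hsub : {γ : HexDomainSAW Ω δ (a δ) (b δ) |
      (⟨γ.walk.toCurve fun v => (δ : ℂ) * hexCenter v⟩ : Curve ℂ).HasTraversals
        (∑ j ∈ Finset.range M, k (c j) w (hh - w)) x ρ R} ⊆
      ⋃ j ∈ Finset.range M, {γ | (⟨γ.walk.toCurve fun v => (δ : ℂ) * hexCenter v⟩ : Curve ℂ).HasTraversals
        (k (c j) w (hh - w)) (c j) w (hh - w)} := by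
    intro γ hγ
    obtain ⟨j, hj, hjT⟩ := Curve.exists_net_hasTraversals_of_hasTraversals hρ.le hρR hM1
      (fun j => k (c j) w (hh - w)) hγ
    refine Set.mem_iUnion₂.2 ⟨j, Finset.mem_range.2 hj, ?_⟩
    have e1 : (R - ρ) / 2 - w = hh - w := by rw [hhh]
    rw [← hw] at hjT
    rw [e1] at hjT
    simpa only [hc, Set.mem_setOf_eq] using hjT
  have hper : ∀ j ∈ Finset.range M,
      hexSAWLaw Ω δ (a δ) (b δ) {γ | (⟨γ.walk.toCurve fun v => (δ : ℂ) * hexCenter v⟩ : Curve ℂ).HasTraversals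
        (k (c j) w (hh - w)) (c j) w (hh - w)} ≤ ENNReal.ofReal (K * (C₀ / M) ^ lam) := by
    intro j _
    refine (h δ hδ' (c j) w (hh - w) hfine (by linarith) (by linarith) (hcin j)).trans
      (ENNReal.ofReal_le_ofReal (mul_le_mul_of_nonneg_left ?_ hK))
    exact Real.rpow_le_rpow (div_nonneg hwpos.le (by linarith)) hratio (by linarith)
  calc hexSAWLaw Ω δ (a δ) (b δ) _
      ≤ hexSAWLaw Ω δ (a δ) (b δ) (⋃ j ∈ Finset.range M, {γ |
          (⟨γ.walk.toCurve fun v => (δ : ℂ) * hexCenter v⟩ : Curve ℂ).HasTraversals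
            (k (c j) w (hh - w)) (c j) w (hh - w)}) := measure_mono hsub
    _ ≤ ∑ j ∈ Finset.range M, hexSAWLaw Ω δ (a δ) (b δ) {γ |
          (⟨γ.walk.toCurve fun v => (δ : ℂ) * hexCenter v⟩ : Curve ℂ).HasTraversals
            (k (c j) w (hh - w)) (c j) w (hh - w)} := measure_biUnion_finset_le _ _
    _ ≤ ∑ j ∈ Finset.range M, ENNReal.ofReal (K * (C₀ / M) ^ lam) := Finset.sum_le_sum hper
    _ = ENNReal.ofReal ((M : ℝ) * (K * (C₀ / M) ^ lam)) := by
        rw [Finset.sum_const, Finset.card_range, nsmul_eq_mul, ← ENNReal.ofReal_natCast M,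
          ← ENNReal.ofReal_mul (Nat.cast_nonneg M)]
    _ ≤ ENNReal.ofReal η := ENNReal.ofReal_le_ofReal hsmall.le

/-- **The assembled reduction of the crux** (for the skeleton owner of the line `reversal-virgin-disc`): an INTERIOR
traversal bound with some exponent `> 1` per `(D, a, b)` — e.g. the landed `Reversal.stub_virginizationTight` output
`InteriorShellBound D a b` (`λ = 3`), itself fed by the two-strand pinch bound through the landed pinch glue — together with
PER-SHELL tightness of the traversal number on thin shells CENTRED IN `(D.carrier)ᶜ` gives the crux `HexTight`
(`interiorPerShellTight_of_interiorBound_one`, `hexTight_of_interiorThin_of_offDomain`). -/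
theorem hexTight_of_interiorBound_one_of_offDomain
    (hI : ∀ (D : DobrushinDomain) (a b : ℝ → HexVertex), IsEmbEndpointApprox hexGraph hexCenter D a b →
      ∃ (k : ℂ → ℝ → ℝ → ℕ) (K lam δ₀ : ℝ), 0 ≤ K ∧ 1 < lam ∧ 0 < δ₀ ∧
        ∀ δ ∈ Set.Ioc (0 : ℝ) δ₀, ∀ (x : ℂ) (ρ R : ℝ), δ ≤ ρ → ρ < R → R ≤ 1 →
          Metric.closedBall x R ⊆ D.carrier →
          hexSAWLaw D.carrier δ (a δ) (b δ)
            {γ | (⟨γ.walk.toCurve fun v => (δ : ℂ) * hexCenter v⟩ : Curve ℂ).HasTraversals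
              (k x ρ R) x ρ R} ≤ ENNReal.ofReal (K * (ρ / R) ^ lam))
    (hC : ∀ (D : DobrushinDomain) (a b : ℝ → HexVertex), IsEmbEndpointApprox hexGraph hexCenter D a b →
      ∀ (x : ℂ) (ρ R : ℝ), 0 < ρ → 4 * ρ < R → R ≤ 1 → x ∉ D.carrier → ∀ η : ℝ, 0 < η →
        ∃ (k : ℕ) (δ₁ : ℝ), 0 < δ₁ ∧ ∀ δ ∈ Set.Ioc (0 : ℝ) δ₁, δ ≤ ρ →
          hexSAWLaw D.carrier δ (a δ) (b δ)
            {γ | (⟨γ.walk.toCurve fun v => (δ : ℂ) * hexCenter v⟩ : Curve ℂ).HasTraversals k x ρ R} ≤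
            ENNReal.ofReal η) :
    Summit.CriticalPhenomena.SAWScalingLimit.Theses.SAWDevelopingMap.HexTight :=
  hexTight_of_interiorThin_of_offDomain
    (fun D a b hab => interiorPerShellTight_of_interiorBound_one D.carrier a b (hI D a b hab)) hC
end Summit.CriticalPhenomena.SAWScalingLimit.Theorems.HexTight.ExponentBootstrap

end
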